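import Summits.HodgeConjecture.HodgeConjecture.Theorems.Ring2AbelianAllAndreTwistedProductRows
import Summits.HodgeConjecture.HodgeConjecture.Theorems.Ring2AbelianAllAndreKunnethComponents
import Summits.HodgeConjecture.HodgeConjecture.Theorems.Ring2AbelianAllAndreCorrespondenceFaithful
import Summits.HodgeConjecture.HodgeConjecture.Theorems.Ring2HypothesesDescentLefschetzBMiddleBlock
import HarnessLib

/-!
# Ring 2 · sub-cell AbelianAll (ALL ABELIAN VARIETIES), André axis, part XLVIII-e — THE CONVERSE: β (hence `B⋆` of the total space) FORCES
# THE WEIL PLANES OF ALL TWISTED PRODUCTS `X_s × X̄_t` TO BE ALGEBRAIC — so, granted Verdier, β at `t` ⟺ Weil-HC for the twisted products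
# of uncountably many members ⟺ of every member

HONEST FRAMING (page 1, verbatim): **research route, not a corollary; conditional on HC_CM plus one named
minimal statement.** Cell line: research route conditional on HC_CM; not a corollary; Q11.4-sentence-2
already refuted in dim ≥ 3. Nothing in this file proves a case of the Hodge conjecture or of `B(X)` for a named `X`: the rows derive algebraicity
of certain Weil classes FROM a half inverse / β / `B⋆(𝒳)`, which are HYPOTHESES. `HC_CM`, `HC_AV` and the global nodes do NOT occur. Item
`Theses.RankFourFaces.CMToAbelian` (stmt-16267) stays OPEN; N104 untouched; no node is born (0 `def`, 0 `sorry`, no named fact). Seat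
`pub-hodge-ring2-ab-andre-2`, gen 40 (part XLVIII).

## Content (theorems only; standard axioms; fact-free except the Verdier binder in the `iff`)

* §1 KÜNNETH ON A MEMBER `X_s × X_t` (part XLV-f for two members): **`map_whiskerRight_cross_eq_pow_smul₂`** (`(ν_s × 𝟙)^*(a ⊠ b) = N^{deg a}(a ⊠ b)`
  for `ν_s` charted by `N·𝟙` on `A_s ≅ X_s`), **`exists_kunnethProjector₂`** (a Lagrange polynomial in `(ν_s × 𝟙)^*` projects `H^{2d}(X_s × X_t)` onto the
  `(k, 2d−k)`-Künneth span, keeping the action on `Hᵏ(X_t)` and killing the others), **`aeval_whiskerRight_mem_algebraicClasses₂`** (polynomials in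
  `(ν_s × 𝟙)^*` preserve `N^d(X_s × X_t)`, Fulton — PROVED in the tree), **`eq_of_mem_kunnethSpan₂_of_corrAction_eq`** (two classes of one Künneth
  summand with the same action on `Hᵏ(X_t)` are equal — part XLV-a's faithfulness).
* §2 **`crossSum_three_restrict_mem_algebraicClasses_of_halfInverse`** — given the three-term data of part XLVIII-b at `t` and an ALGEBRAIC half
  inverse at `t` in degree `2p`, the class `θ_s ⊠ θ'_t + u₊(s) ⊠ u'₋(t) + u₋(s) ⊠ u'₊(t)` is ALGEBRAIC on `X_s × X_t` for EVERY member carrying a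
  `θ_N`-chart: both it (times `c`) and the restriction of the algebraic half-inverse cycle act on `H^{2p}(X_t)` as the transport (parts XLVI-c §1, §3),
  the Künneth component of the latter is algebraic and lies in the same summand, so they coincide (§1).
* §3 **`weilClassesOf_twistedProd_le_algebraicClasses_of_halfInverse`** — hence, with Weil charts `(A_s, φ_s)`, `(A_t, φ_t)` and a twisted `Φ` on
  `A_s × A_t`: the Weil plane of `(A_s × A_t, Φ)` consists of algebraic classes (part XLVIII-a: one algebraic mixed class with non-zero components
  suffices; `u₊(s) ≠ 0 ≠ u'₋(t)` from `∫ u₊(t) ∪ u'₋(t) = 1` and `ker j_s^* = ker j_t^*`); **`…_of_betaInverse`** (from β at `t` in the middle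
  degree), **`…_of_lefschetzB`** (from `B⋆(𝒳, η) ∀η`).
* §4 **`betaInverse_iff_weilPlanes_twistedProd_of_verdier`** — granted Verdier, on a compact pencil of abelian `2n`-folds with the data of part
  XLVIII-c §2 and `θ_N`-charts at every member: **β at `t` in degree `2n` ⟺ the Weil planes of the twisted products `(A_s × A_t, Φ_s)` are algebraic
  for UNCOUNTABLY many `s` ⟺ for EVERY `s`.**

## Honest status

This closes the identification of part XLVIII: for the W₂ₙ pencils the single open input of the André axis (β ⟺ `B⋆(𝒳)`, parts XXXIX–XLVII) is
EXACTLY the Weil Hodge conjecture for the conjugate-twisted products `X_s × X̄_t` of two members — Weil-type abelian `4n`-folds which in print are of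
SPLIT discriminant (`δ_s δ̄_t = δ² ∈ N(K^×)`; kernel: ab-weil-1's `Ring2AbelianAllWeilTwistedProducts` + part XLIX, isodiscriminantal members)
— on uncountably many (equivalently all) members `s`. W₆: split-type twelvefolds of
product shape. Strength therefore UNCHANGED and now pinned on the cell's Hodge–Weil ladder; necessary direction fact-free. Nothing minimal is
claimed; N104 untouched. EDGE LABELS: K (§1–§3), K[Verdier] (§4).
References: Kleiman1968AlgebraicCycles (§1.3, 2A11); DeningerMurre1991 (Thm. 3.1); Fulton1998 (Thm. 6.2 (a), §16.1, Cor. 19.2 (b));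
VoisinHodgeII2003 ((10.7)); vanGeemen1994HodgeAV (4.9, Lemma 5.2 (6), (5.4.1)); Schoen1998HodgeWeilAddendum (§10); Verdier1976 (Cor. (5.1));
Andre1996Motifs (Prop. 3.3, §5.1); Tankeev2003 (Thm. 10.1).
-/

noncomputable section

set_option linter.dupNamespace false

namespace Summit.HodgeConjecture.HodgeConjecture.Ring2.AbelianAll

open CategoryTheory CategoryTheory.Limits AlgebraicGeometry MonoidalCategory CartesianMonoidalCategory
open Literature.AlgebraicGeometry Literature.AlgebraicGeometry.Motives
open Literature.AlgebraicGeometry.HodgeTheory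
open Literature.AlgebraicTopology.SingularHomology (singularCohomology cupProduct cupProduct_map)
open Summit.HodgeConjecture.HodgeConjecture.Theorems (deg_fiberGysin_aux fulton1998_map_mem_algebraicClasses_holds)
open Polynomial

variable {𝒳 S : SchemeOver ℂ} {d : ℕ} {f : 𝒳 ⟶ S} (hf : IsCompactAbelianPencil f d)

/-- `𝐆[hf, s, k]` — `j_{s*}` for the complex orientations (display notation, as in part XL-a). [cite: FultonYoungTableaux1997, Appendix B §B.1 (5)] -/
local notation3 (prettyPrint := false) "𝐆[" hf ", " s ", " k "]" =>
  complexGysin complexOrientationFamily (IsCompactAbelianPencil.isSmoothProjective_fiberOver hf s)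
    (IsCompactAbelianPencil.isSmoothProjective_total hf) (fiberι f s) (deg_fiberGysin_aux k d)

/-- `𝐣[s, k]` — `j_s^*` as a linear map (display notation). [cite: VoisinHodgeI2002, §7.3.2] -/
local notation3 (prettyPrint := false) "𝐣[" s ", " k "]" => (complexBetti.map (fiberι f s) k).hom

/-- `𝐌[hf, t, hab]` — the action of a class of `𝒳 × X_t` as a correspondence `H^•(X_t) → H^•(𝒳)` (display notation for `corrAction`).
[cite: VoisinHodgeII2003, proof of Thm. 10.17 (10.7)] -/
local notation3 (prettyPrint := false) "𝐌[" hf ", " t ", " hab "]" =>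
  corrAction complexOrientationFamily (IsCompactAbelianPencil.isSmoothProjective_total hf)
    (IsCompactAbelianPencil.isSmoothProjective_fiberOver hf t) hab

/-- `𝐑₂[hf, s, t, k]` — the action `Hᵏ(X_t) → Hᵏ(X_s)` of a codimension-`d` class of `X_s × X_t` (display notation). [cite: VoisinHodgeII2003, proof of Thm. 10.17 (10.7)] -/
local notation3 (prettyPrint := false) "𝐑₂[" hf ", " s ", " t ", " k "]" =>
  corrAction complexOrientationFamily (IsCompactAbelianPencil.isSmoothProjective_fiberOver hf s)
    (IsCompactAbelianPencil.isSmoothProjective_fiberOver hf t) (rfl : k + 2 * d = k + 2 * d)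

/-- `𝐫[s, t, n]` — restriction `(j_s × 1)^*` to the member `X_s × X_t` (display notation). [cite: Fulton1998, §19.2 Cor. 19.2 (b)] -/
local notation3 (prettyPrint := false) "𝐫[" s ", " t ", " n "]" => complexBetti.map (fiberι f s ▷ fiberOver f t) n

/-- `𝒮₂[s, t, k]` — the `(k, 2d−k)`-Künneth span of `H^{2d}((X_s × X_t)(ℂ); ℂ)` (display notation, as in part XLVII-a). [cite: HatcherAT2002, §3.2 Thm. 3.15] -/
local notation3 (prettyPrint := false) "𝒮₂[" s ", " t ", " k "]" => Submodule.span ℂ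
  {v : complexBetti (fiberOver f s ⊗ fiberOver f t) (2 * d) |
    ∃ (j : ℕ) (h : k + j = 2 * d) (a : complexBetti (fiberOver f s) k) (b : complexBetti (fiberOver f t) j),
      v = cupProduct h (complexBetti.map (fst (fiberOver f s) (fiberOver f t)) k a)
        (complexBetti.map (snd (fiberOver f s) (fiberOver f t)) j b)}

/-- `∫[hf, t]` — the canonical complex trace of the fibre `X_t` (display notation for the tree's `traceC`). [cite: HatcherAT2002, §3.3 p. 241] -/
local notation3 (prettyPrint := false) "∫[" hf ", " t "]" => traceC (IsCompactAbelianPencil.isSmoothProjective_fiberOver hf t)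

/-! ## §1 Künneth components on a member `X_s × X_t` -/

section Kunneth

/-- **`(ν_s × 𝟙)^*(pr_1^* a ∪ pr_2^* b) = N^{deg a} · (pr_1^* a ∪ pr_2^* b)`** on `X_s × X_t`, for `ν_s` charted by `N · 𝟙` on `A_s ≅ X_s` (part XLV-f §2
for two members). [cite: Kleiman1968AlgebraicCycles, Appendix to §2, 2A11] [cite: HatcherAT2002, §3.2 Prop. 3.10] -/
theorem map_whiskerRight_cross_eq_pow_smul₂ (s t : ComplexPoints S) (νs : fiberOver f s ⟶ fiberOver f s) (A : AbelianVariety ℂ)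
    (e : A.X ≅ fiberOver f s) {N : ℕ} (he : e.hom ≫ νs = (N • 𝟙 A).hom.hom.hom ≫ e.hom) {i j n : ℕ} (h : i + j = n)
    (a : complexBetti (fiberOver f s) i) (b : complexBetti (fiberOver f t) j) :
    complexBetti.map (νs ▷ fiberOver f t) n
        (cupProduct h (complexBetti.map (fst (fiberOver f s) (fiberOver f t)) i a) (complexBetti.map (snd (fiberOver f s) (fiberOver f t)) j b)) =
      ((N : ℂ) ^ i) • cupProduct h (complexBetti.map (fst (fiberOver f s) (fiberOver f t)) i a)
        (complexBetti.map (snd (fiberOver f s) (fiberOver f t)) j b) := by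
  have e₁ : complexBetti.map (νs ▷ fiberOver f t) i (complexBetti.map (fst (fiberOver f s) (fiberOver f t)) i a) =
      ((N : ℂ) ^ i) • complexBetti.map (fst (fiberOver f s) (fiberOver f t)) i a := by
    rw [← complexBetti.map_comp_apply, whiskerRight_fst, complexBetti.map_comp_apply, map_fibreEndo_eq_pow_smul s νs A e he i a, map_smul]
  have e₂ : complexBetti.map (νs ▷ fiberOver f t) j (complexBetti.map (snd (fiberOver f s) (fiberOver f t)) j b) =
      complexBetti.map (snd (fiberOver f s) (fiberOver f t)) j b := by
    rw [← complexBetti.map_comp_apply, whiskerRight_snd]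
  rw [cupProduct_map, e₁, e₂, LinearMap.map_smul₂]

/-- **THE KÜNNETH PROJECTOR ON A MEMBER `X_s × X_t`** (part XLV-f §3 for two members): with `ν_s` charted by `N·𝟙` (`N ≥ 2`) on `A_s ≅ X_s` and
`k ≤ 2d`, a Lagrange polynomial `p` in `(ν_s × 𝟙)^*` satisfies: `p R ∈ 𝒮₂_k` for every `R ∈ H^{2d}(X_s × X_t)`, `[p R]_* = [R]_*` on `Hᵏ(X_t)`, and
`[p R]_* = 0` on `H^{k'}(X_t)` for `k' ≠ k`. [cite: Kleiman1968AlgebraicCycles, §1.3 and Appendix to §2, 2A11] [cite: DeningerMurre1991, Thm. 3.1]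
[cite: HatcherAT2002, §3.2 Thm. 3.15] -/
theorem exists_kunnethProjector₂ (s t : ComplexPoints S) (νs : fiberOver f s ⟶ fiberOver f s) (A : AbelianVariety ℂ)
    (e : A.X ≅ fiberOver f s) {N : ℕ} (hN : 2 ≤ N) (he : e.hom ≫ νs = (N • 𝟙 A).hom.hom.hom ≫ e.hom) {k : ℕ} (hk : k ≤ 2 * d) :
    ∃ p : ℂ[X], ∀ R : complexBetti (fiberOver f s ⊗ fiberOver f t) (2 * d),
      aeval (complexBetti.map (νs ▷ fiberOver f t) (2 * d)).hom p R ∈ 𝒮₂[s, t, k] ∧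
        𝐑₂[hf, s, t, k] (aeval (complexBetti.map (νs ▷ fiberOver f t) (2 * d)).hom p R) = 𝐑₂[hf, s, t, k] R ∧
        ∀ k' : ℕ, k' ≠ k → 𝐑₂[hf, s, t, k'] (aeval (complexBetti.map (νs ▷ fiberOver f t) (2 * d)).hom p R) = 0 := by
  have hXs := hf.isSmoothProjective_fiberOver s
  have hXt := hf.isSmoothProjective_fiberOver t
  obtain ⟨w, hw⟩ : ∃ w : ℕ → ℂ, ∀ i, w i = (N : ℂ) ^ i := ⟨_, fun _ ↦ rfl⟩
  have hwinj : ∀ i j, w i = w j → i = j := by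
    intro i j h
    rw [hw, hw] at h
    exact Nat.pow_right_injective hN (by exact_mod_cast h)
  refine ⟨C (∏ j ∈ (Finset.range (2 * d + 1)).erase k, (w k - w j))⁻¹ * ∏ j ∈ (Finset.range (2 * d + 1)).erase k, (X - C (w j)),
    fun R ↦ ?_⟩
  have hcross : ∀ (i j : ℕ) (h : i + j = 2 * d) (a : complexBetti (fiberOver f s) i) (b : complexBetti (fiberOver f t) j),
      aeval (complexBetti.map (νs ▷ fiberOver f t) (2 * d)).hom
        (C (∏ j ∈ (Finset.range (2 * d + 1)).erase k, (w k - w j))⁻¹ * ∏ j ∈ (Finset.range (2 * d + 1)).erase k, (X - C (w j)))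
        (cupProduct h (complexBetti.map (fst (fiberOver f s) (fiberOver f t)) i a)
          (complexBetti.map (snd (fiberOver f s) (fiberOver f t)) j b)) =
      (if i = k then (1 : ℂ) else 0) • cupProduct h (complexBetti.map (fst (fiberOver f s) (fiberOver f t)) i a)
        (complexBetti.map (snd (fiberOver f s) (fiberOver f t)) j b) := by
    intro i j h a b
    have heig := map_whiskerRight_cross_eq_pow_smul₂ s t νs A e he h a b
    rw [← hw i] at heig
    rw [aeval_apply_of_apply_eq_smul _ heig, eval_lagrangeNode w hwinj (m := 2 * d) hk (show i ≤ 2 * d by omega)]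
  refine ⟨?_, ?_, fun k' hk' ↦ ?_⟩
  · refine Submodule.span_induction ?_ ?_ (fun x y _ _ hx hy ↦ ?_) (fun c x _ hx ↦ ?_) (kunnethSpan_complexBetti hXs hXt (2 * d) R)
    · rintro _ ⟨i, j, h, a, b, rfl⟩
      rw [hcross i j h a b]
      split_ifs with hik
      · subst hik
        rw [one_smul]
        exact Submodule.subset_span ⟨j, h, a, b, rfl⟩
      · rw [zero_smul]
        exact Submodule.zero_mem _
    · rw [map_zero]
      exact Submodule.zero_mem _
    · rw [map_add]
      exact Submodule.add_mem _ hx hy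
    · rw [map_smul]
      exact Submodule.smul_mem _ c hx
  · have key : Set.EqOn
        (𝐑₂[hf, s, t, k] ∘ₗ aeval (complexBetti.map (νs ▷ fiberOver f t) (2 * d)).hom
          (C (∏ j ∈ (Finset.range (2 * d + 1)).erase k, (w k - w j))⁻¹ * ∏ j ∈ (Finset.range (2 * d + 1)).erase k, (X - C (w j))))
        𝐑₂[hf, s, t, k]
        {v | ∃ (i j : ℕ) (h : i + j = 2 * d) (a : complexBetti (fiberOver f s) i) (b : complexBetti (fiberOver f t) j),
          v = cupProduct h (complexBetti.map (fst (fiberOver f s) (fiberOver f t)) i a)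
            (complexBetti.map (snd (fiberOver f s) (fiberOver f t)) j b)} := by
      rintro _ ⟨i, j, h, a, b, rfl⟩
      rw [LinearMap.comp_apply, hcross i j h a b]
      split_ifs with hik
      · rw [one_smul]
      · rw [zero_smul, map_zero]
        refine (LinearMap.ext fun c ↦ ?_).symm
        rw [LinearMap.zero_apply]
        exact corrAction_cross_eq_zero_of_ne hXs hXt h rfl (by omega) a b c
    exact LinearMap.eqOn_span' key (kunnethSpan_complexBetti hXs hXt (2 * d) R)
  · have key : Set.EqOn
        (𝐑₂[hf, s, t, k'] ∘ₗ aeval (complexBetti.map (νs ▷ fiberOver f t) (2 * d)).hom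
          (C (∏ j ∈ (Finset.range (2 * d + 1)).erase k, (w k - w j))⁻¹ * ∏ j ∈ (Finset.range (2 * d + 1)).erase k, (X - C (w j))))
        (0 : complexBetti (fiberOver f s ⊗ fiberOver f t) (2 * d) →ₗ[ℂ]
          (complexBetti (fiberOver f t) k' →ₗ[ℂ] complexBetti (fiberOver f s) k'))
        {v | ∃ (i j : ℕ) (h : i + j = 2 * d) (a : complexBetti (fiberOver f s) i) (b : complexBetti (fiberOver f t) j),
          v = cupProduct h (complexBetti.map (fst (fiberOver f s) (fiberOver f t)) i a)
            (complexBetti.map (snd (fiberOver f s) (fiberOver f t)) j b)} := by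
      rintro _ ⟨i, j, h, a, b, rfl⟩
      rw [LinearMap.comp_apply, LinearMap.zero_apply, hcross i j h a b]
      split_ifs with hik
      · subst hik
        rw [one_smul]
        refine LinearMap.ext fun c ↦ ?_
        rw [LinearMap.zero_apply]
        exact corrAction_cross_eq_zero_of_ne hXs hXt h rfl (by omega) a b c
      · rw [zero_smul, map_zero]
    have h := LinearMap.eqOn_span' key (kunnethSpan_complexBetti hXs hXt (2 * d) R)
    simpa only [LinearMap.comp_apply, LinearMap.zero_apply] using h

include hf in
/-- **Polynomials in `(ν_s × 𝟙)^*` preserve the algebraic classes of `X_s × X_t`** (pull-back along an endomorphism of a smooth projective variety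
preserves `N^d` — Fulton Cor. 19.2 (b), PROVED in the tree). [cite: Fulton1998, §19.2 Cor. 19.2 (b)] -/
theorem aeval_whiskerRight_mem_algebraicClasses₂ (s t : ComplexPoints S) (νs : fiberOver f s ⟶ fiberOver f s) (p : ℂ[X])
    {R : complexBetti (fiberOver f s ⊗ fiberOver f t) (2 * d)} (hR : R ∈ algebraicClasses (fiberOver f s ⊗ fiberOver f t) d) :
    aeval (complexBetti.map (νs ▷ fiberOver f t) (2 * d)).hom p R ∈ algebraicClasses (fiberOver f s ⊗ fiberOver f t) d := by
  have hst := (hf.isSmoothProjective_fiberOver s).tensor_holds (hf.isSmoothProjective_fiberOver t)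
  exact aeval_apply_mem_of_stable _ _ (fun x hx ↦ fulton1998_map_mem_algebraicClasses_holds (νs ▷ fiberOver f t) hst hst d x hx) p hR

/-- **A class of the `(k, 2d−k)`-summand of `X_s × X_t` acts as zero on `H^{k'}(X_t)` for `k' ≠ k`.** [cite: Kleiman1968AlgebraicCycles, §1.3] -/
theorem corrAction_eq_zero_of_mem_kunnethSpan₂_of_ne (s t : ComplexPoints S) {k k' : ℕ} (hk' : k' ≠ k)
    {R : complexBetti (fiberOver f s ⊗ fiberOver f t) (2 * d)} (hR : R ∈ 𝒮₂[s, t, k]) : 𝐑₂[hf, s, t, k'] R = 0 := by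
  have hXs := hf.isSmoothProjective_fiberOver s
  have hXt := hf.isSmoothProjective_fiberOver t
  refine Submodule.span_induction ?_ (by rw [map_zero]) (fun x y _ _ hx hy ↦ by rw [map_add, hx, hy, add_zero])
    (fun c x _ hx ↦ by rw [map_smul, hx, smul_zero]) hR
  rintro _ ⟨j, h, a, b, rfl⟩
  refine LinearMap.ext fun c ↦ ?_
  rw [LinearMap.zero_apply]
  exact corrAction_cross_eq_zero_of_ne hXs hXt h rfl (by omega) a b c

/-- **Two classes of the `(k, 2d−k)`-summand of `X_s × X_t` with the same action on `Hᵏ(X_t)` are equal** (part XLV-a's faithfulness for `X_s × X_t`).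
[cite: Kleiman1968AlgebraicCycles, §1.3] [cite: Fulton1998, §16.1 Def. 16.1.2] -/
theorem eq_of_mem_kunnethSpan₂_of_corrAction_eq (s t : ComplexPoints S) {k : ℕ}
    {R₁ R₂ : complexBetti (fiberOver f s ⊗ fiberOver f t) (2 * d)} (h₁ : R₁ ∈ 𝒮₂[s, t, k]) (h₂ : R₂ ∈ 𝒮₂[s, t, k])
    (h : 𝐑₂[hf, s, t, k] R₁ = 𝐑₂[hf, s, t, k] R₂) : R₁ = R₂ := by
  refine eq_of_corrAction_eq_allDegrees complexOrientationFamily (hf.isSmoothProjective_fiberOver s) (hf.isSmoothProjective_fiberOver t)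
    fun a b hab _ _ ↦ ?_
  obtain rfl : a = b := by omega
  by_cases hak : a = k
  · subst hak
    exact h
  · change 𝐑₂[hf, s, t, a] R₁ = 𝐑₂[hf, s, t, a] R₂
    rw [corrAction_eq_zero_of_mem_kunnethSpan₂_of_ne hf s t hak h₁, corrAction_eq_zero_of_mem_kunnethSpan₂_of_ne hf s t hak h₂]

end Kunneth

/-! ## §2 A half inverse at `t` makes the three-term classes algebraic on EVERY member -/

section Necessary

/-- **AN ALGEBRAIC HALF INVERSE AT `t` MAKES `θ_s ⊠ θ'_t + u₊(s) ⊠ u'₋(t) + u₋(s) ⊠ u'₊(t)` ALGEBRAIC ON EVERY MEMBER `X_s × X_t`** (with a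
`θ_N`-chart at `s`). See the module docstring, §2. [cite: Fulton1998, Thm. 6.2 (a) and Cor. 19.2 (b)] [cite: Kleiman1968AlgebraicCycles, §1.3 and 2A11]
[cite: VoisinHodgeI2002, §11.3.3 Lemma 11.41 (11.11)] [cite: DeligneHodgeII1971, Thm. 4.1.1] -/
theorem crossSum_three_restrict_mem_algebraicClasses_of_halfInverse (t s : ComplexPoints S) {p q : ℕ} (hpq : p + q = d)
    (Θ Up Um : complexBetti 𝒳 (2 * p)) (Θ' U'm U'p : complexBetti 𝒳 (2 * q))
    (hθθ : ∫[hf, t] (cupProduct (show 2 * p + 2 * q = 2 * d by omega) (𝐣[t, 2 * p] Θ) (𝐣[t, 2 * q] Θ')) = 1)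
    (hθm : ∫[hf, t] (cupProduct (show 2 * p + 2 * q = 2 * d by omega) (𝐣[t, 2 * p] Θ) (𝐣[t, 2 * q] U'm)) = 0)
    (hθp : ∫[hf, t] (cupProduct (show 2 * p + 2 * q = 2 * d by omega) (𝐣[t, 2 * p] Θ) (𝐣[t, 2 * q] U'p)) = 0)
    (hpθ : ∫[hf, t] (cupProduct (show 2 * p + 2 * q = 2 * d by omega) (𝐣[t, 2 * p] Up) (𝐣[t, 2 * q] Θ')) = 0)
    (hpm : ∫[hf, t] (cupProduct (show 2 * p + 2 * q = 2 * d by omega) (𝐣[t, 2 * p] Up) (𝐣[t, 2 * q] U'm)) = 1)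
    (hpp : ∫[hf, t] (cupProduct (show 2 * p + 2 * q = 2 * d by omega) (𝐣[t, 2 * p] Up) (𝐣[t, 2 * q] U'p)) = 0)
    (hmθ : ∫[hf, t] (cupProduct (show 2 * p + 2 * q = 2 * d by omega) (𝐣[t, 2 * p] Um) (𝐣[t, 2 * q] Θ')) = 0)
    (hmm : ∫[hf, t] (cupProduct (show 2 * p + 2 * q = 2 * d by omega) (𝐣[t, 2 * p] Um) (𝐣[t, 2 * q] U'm)) = 0)
    (hmp : ∫[hf, t] (cupProduct (show 2 * p + 2 * q = 2 * d by omega) (𝐣[t, 2 * p] Um) (𝐣[t, 2 * q] U'p)) = 1)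
    (hspan : ∀ W : complexBetti 𝒳 (2 * p), ∃ a b c : ℂ, 𝐣[t, 2 * p] W = a • 𝐣[t, 2 * p] Θ + b • 𝐣[t, 2 * p] Up + c • 𝐣[t, 2 * p] Um)
    (νs : fiberOver f s ⟶ fiberOver f s) (As : AbelianVariety ℂ) (es : As.X ≅ fiberOver f s) {N : ℕ} (hN : 2 ≤ N)
    (hes : es.hom ≫ νs = (N • 𝟙 As).hom.hom.hom ≫ es.hom)
    (hM : ∃ M : complexBetti (fiberOver f t) (2 * p) →ₗ[ℂ] complexBetti 𝒳 (2 * p), IsAlgebraicCorrespondence (d + 1) d 𝒳 (fiberOver f t) M ∧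
      (∀ W, 𝐣[t, 2 * p] (M (𝐣[t, 2 * p] W)) = 𝐣[t, 2 * p] W) ∧ ∀ x, 𝐆[hf, t, 2 * p] x = 0 → 𝐣[t, 2 * p] (M x) = 0) :
    cupProduct (show 2 * p + 2 * q = 2 * d by omega) (complexBetti.map (fst (fiberOver f s) (fiberOver f t)) (2 * p) (𝐣[s, 2 * p] Θ))
          (complexBetti.map (snd (fiberOver f s) (fiberOver f t)) (2 * q) (𝐣[t, 2 * q] Θ')) +
        cupProduct (show 2 * p + 2 * q = 2 * d by omega) (complexBetti.map (fst (fiberOver f s) (fiberOver f t)) (2 * p) (𝐣[s, 2 * p] Up))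
          (complexBetti.map (snd (fiberOver f s) (fiberOver f t)) (2 * q) (𝐣[t, 2 * q] U'm)) +
        cupProduct (show 2 * p + 2 * q = 2 * d by omega) (complexBetti.map (fst (fiberOver f s) (fiberOver f t)) (2 * p) (𝐣[s, 2 * p] Um))
          (complexBetti.map (snd (fiberOver f s) (fiberOver f t)) (2 * q) (𝐣[t, 2 * q] U'p)) ∈
      algebraicClasses (fiberOver f s ⊗ fiberOver f t) d := by
  have hX := hf.isSmoothProjective_total
  have hXt := hf.isSmoothProjective_fiberOver t
  have h2 : 2 * p + 2 * q = 2 * d := by omega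
  -- the three-term topological half inverse and its member restrictions
  set Γ₃ : complexBetti (𝒳 ⊗ fiberOver f t) (2 * d) :=
    cupProduct h2 (complexBetti.map (fst 𝒳 (fiberOver f t)) (2 * p) Θ) (complexBetti.map (snd 𝒳 (fiberOver f t)) (2 * q) (𝐣[t, 2 * q] Θ')) +
      cupProduct h2 (complexBetti.map (fst 𝒳 (fiberOver f t)) (2 * p) Up) (complexBetti.map (snd 𝒳 (fiberOver f t)) (2 * q) (𝐣[t, 2 * q] U'm)) +
      cupProduct h2 (complexBetti.map (fst 𝒳 (fiberOver f t)) (2 * p) Um) (complexBetti.map (snd 𝒳 (fiberOver f t)) (2 * q) (𝐣[t, 2 * q] U'p))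
    with hΓ₃
  obtain ⟨⟨c, hc0, hW₀, hW₀0⟩, hres⟩ := crossSum_three_halfInverse hf t hpq Θ Up Um Θ' U'm U'p hθθ hθm hθp hpθ hpm hpp hmθ hmm hmp hspan hΓ₃
  -- the algebraic half inverse as a cycle `μ` on `𝒳 × X_t`
  obtain ⟨M, algM, hMid, hM0⟩ := hM
  obtain ⟨e', hab, μ, hμ, rfl⟩ := IsAlgebraicCorrespondence.exists_eq_corrAction hX hXt algM
  obtain rfl : d = e' := by omega
  -- both act as THE transport `H^{2p}(X_t) → H^{2p}(X_s)` after `j_s^*`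
  have hMs := map_fiberι_halfInverse_eq hf t s (𝐌[hf, t, hab] μ) hMid hM0
  have hM₀s := map_fiberι_halfInverse_eq hf t s (𝐌[hf, t, (rfl : 2 * p + 2 * d = 2 * p + 2 * d)] (c • Γ₃)) hW₀
    (fun x hx ↦ by rw [hW₀0 x hx, map_zero])
  have htr : 𝐣[s, 2 * p] ∘ₗ 𝐌[hf, t, hab] μ = 𝐣[s, 2 * p] ∘ₗ 𝐌[hf, t, (rfl : 2 * p + 2 * d = 2 * p + 2 * d)] (c • Γ₃) :=
    transport_unique' hf t s _ _ (fun W ↦ hMs.1 W) (fun x hx ↦ hMs.2 x hx) (fun W ↦ hM₀s.1 W) (fun x hx ↦ hM₀s.2 x hx)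
  -- clean base change: the restricted classes act alike on `H^{2p}(X_t)`
  obtain ⟨K, hK0, hK⟩ := exists_map_fiberι_corrAction_eq_smul_restrict hf s t
  set R₁ : complexBetti (fiberOver f s ⊗ fiberOver f t) (2 * d) := 𝐫[s, t, 2 * d] μ with hR₁
  set R₂ : complexBetti (fiberOver f s ⊗ fiberOver f t) (2 * d) := 𝐫[s, t, 2 * d] (c • Γ₃) with hR₂
  have hact : 𝐑₂[hf, s, t, 2 * p] R₁ = 𝐑₂[hf, s, t, 2 * p] R₂ := by
    refine LinearMap.ext fun x ↦ smul_right_injective _ hK0 ?_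
    change K • 𝐑₂[hf, s, t, 2 * p] R₁ x = K • 𝐑₂[hf, s, t, 2 * p] R₂ x
    rw [hR₁, hR₂, ← hK (rfl : 2 * p + 2 * d = 2 * p + 2 * d) μ x, ← hK (rfl : 2 * p + 2 * d = 2 * p + 2 * d) (c • Γ₃) x]
    exact congrArg (fun L : complexBetti (fiberOver f t) (2 * p) →ₗ[ℂ] complexBetti (fiberOver f s) (2 * p) ↦ L x) htr
  -- `R₂ = c • (three-term class)` lies in the Künneth summand `𝒮₂_{2p}`
  have hR₂eq : R₂ = c • (cupProduct h2 (complexBetti.map (fst (fiberOver f s) (fiberOver f t)) (2 * p) (𝐣[s, 2 * p] Θ))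
          (complexBetti.map (snd (fiberOver f s) (fiberOver f t)) (2 * q) (𝐣[t, 2 * q] Θ')) +
        cupProduct h2 (complexBetti.map (fst (fiberOver f s) (fiberOver f t)) (2 * p) (𝐣[s, 2 * p] Up))
          (complexBetti.map (snd (fiberOver f s) (fiberOver f t)) (2 * q) (𝐣[t, 2 * q] U'm)) +
        cupProduct h2 (complexBetti.map (fst (fiberOver f s) (fiberOver f t)) (2 * p) (𝐣[s, 2 * p] Um))
          (complexBetti.map (snd (fiberOver f s) (fiberOver f t)) (2 * q) (𝐣[t, 2 * q] U'p))) := by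
    rw [hR₂, map_smul, hres s]
  have hR₂S : R₂ ∈ 𝒮₂[s, t, 2 * p] := by
    rw [hR₂eq]
    refine Submodule.smul_mem _ c (Submodule.add_mem _ (Submodule.add_mem _ ?_ ?_) ?_) <;>
      exact Submodule.subset_span ⟨2 * q, h2, _, _, rfl⟩
  -- the Künneth component of `R₁` is algebraic, lies in `𝒮₂_{2p}`, and has the action of `R₂`
  obtain ⟨pk, hpk⟩ := exists_kunnethProjector₂ hf s t νs As es hN hes (k := 2 * p) (by omega)
  obtain ⟨h1, h2', h3⟩ := hpk R₁
  have halg₁ : aeval (complexBetti.map (νs ▷ fiberOver f t) (2 * d)).hom pk R₁ ∈ algebraicClasses (fiberOver f s ⊗ fiberOver f t) d :=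
    aeval_whiskerRight_mem_algebraicClasses₂ hf s t νs pk (map_whiskerRight_fiberι_mem_algebraicClasses hf s t hμ)
  have heq : aeval (complexBetti.map (νs ▷ fiberOver f t) (2 * d)).hom pk R₁ = R₂ :=
    eq_of_mem_kunnethSpan₂_of_corrAction_eq hf s t h1 hR₂S (by rw [h2', hact])
  rw [heq, hR₂eq] at halg₁
  have h := Submodule.smul_mem _ c⁻¹ halg₁
  rwa [smul_smul, inv_mul_cancel₀ hc0, one_smul] at h

/-- **HENCE A HALF INVERSE AT `t` MAKES THE WEIL PLANE OF THE TWISTED PRODUCT `(A_s × A_t, Φ)` ALGEBRAIC, FOR EVERY MEMBER `s`** (with Weil charts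
`(A_s, φ_s)`, `(A_t, φ_t)`, `φ² = −d_K`, `Φ` compatible with `φ_s` and `−φ_t`, the restricted classes `u±(s)`, `u'∓(t)` in the Weil lines, `θ_s`, `θ'_t`
algebraic, and a `θ_N`-chart at `s` along the same `e_s`). Part XLVIII-a: one algebraic mixed class with `u₊(s) ≠ 0 ≠ u'₋(t)` suffices.
[cite: vanGeemen1994HodgeAV, 4.9 and proof of Thm. 6.12] [cite: Schoen1998HodgeWeilAddendum, §10 (proof of the Proposition)] [cite: Fulton1998, §19.2 Cor. 19.2 (b)] -/
theorem weilClassesOf_twistedProd_le_algebraicClasses_of_halfInverse (t s : ComplexPoints S) {n : ℕ} (hn : n + n = d) (hn0 : 0 < n)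
    (Θ Up Um Θ' U'm U'p : complexBetti 𝒳 (2 * n))
    (hθθ : ∫[hf, t] (cupProduct (show 2 * n + 2 * n = 2 * d by omega) (𝐣[t, 2 * n] Θ) (𝐣[t, 2 * n] Θ')) = 1)
    (hθm : ∫[hf, t] (cupProduct (show 2 * n + 2 * n = 2 * d by omega) (𝐣[t, 2 * n] Θ) (𝐣[t, 2 * n] U'm)) = 0)
    (hθp : ∫[hf, t] (cupProduct (show 2 * n + 2 * n = 2 * d by omega) (𝐣[t, 2 * n] Θ) (𝐣[t, 2 * n] U'p)) = 0)
    (hpθ : ∫[hf, t] (cupProduct (show 2 * n + 2 * n = 2 * d by omega) (𝐣[t, 2 * n] Up) (𝐣[t, 2 * n] Θ')) = 0)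
    (hpm : ∫[hf, t] (cupProduct (show 2 * n + 2 * n = 2 * d by omega) (𝐣[t, 2 * n] Up) (𝐣[t, 2 * n] U'm)) = 1)
    (hpp : ∫[hf, t] (cupProduct (show 2 * n + 2 * n = 2 * d by omega) (𝐣[t, 2 * n] Up) (𝐣[t, 2 * n] U'p)) = 0)
    (hmθ : ∫[hf, t] (cupProduct (show 2 * n + 2 * n = 2 * d by omega) (𝐣[t, 2 * n] Um) (𝐣[t, 2 * n] Θ')) = 0)
    (hmm : ∫[hf, t] (cupProduct (show 2 * n + 2 * n = 2 * d by omega) (𝐣[t, 2 * n] Um) (𝐣[t, 2 * n] U'm)) = 0)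
    (hmp : ∫[hf, t] (cupProduct (show 2 * n + 2 * n = 2 * d by omega) (𝐣[t, 2 * n] Um) (𝐣[t, 2 * n] U'p)) = 1)
    (hspan : ∀ W : complexBetti 𝒳 (2 * n), ∃ a b c : ℂ, 𝐣[t, 2 * n] W = a • 𝐣[t, 2 * n] Θ + b • 𝐣[t, 2 * n] Up + c • 𝐣[t, 2 * n] Um)
    (hΘ : 𝐣[s, 2 * n] Θ ∈ algebraicClasses (fiberOver f s) n) (hΘ' : 𝐣[t, 2 * n] Θ' ∈ algebraicClasses (fiberOver f t) n)
    (As At : AbelianVariety ℂ) (es : As.X ≅ fiberOver f s) (et : At.X ≅ fiberOver f t) (νs : fiberOver f s ⟶ fiberOver f s) {N : ℕ} (hN : 2 ≤ N)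
    (hes : es.hom ≫ νs = (N • 𝟙 As).hom.hom.hom ≫ es.hom) {dK : ℕ} (hdK : 0 < dK) (φs : As ⟶ As) (φt : At ⟶ At)
    (hφs : φs ≫ φs = -(dK • 𝟙 As)) (hφt : φt ≫ φt = -(dK • 𝟙 At)) (Φ : As.prod At ⟶ As.prod At)
    (hΦ₁ : Φ ≫ Motives.AbelianVariety.fst As At = Motives.AbelianVariety.fst As At ≫ φs)
    (hΦ₂ : Φ ≫ Motives.AbelianVariety.snd As At = Motives.AbelianVariety.snd As At ≫ (-φt))
    (hUp : complexBetti.map es.hom (2 * n) (𝐣[s, 2 * n] Up) ∈ weilClassesPlus As φs n dK)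
    (hUm : complexBetti.map es.hom (2 * n) (𝐣[s, 2 * n] Um) ∈ weilClassesMinus As φs n dK)
    (hU'm : complexBetti.map et.hom (2 * n) (𝐣[t, 2 * n] U'm) ∈ weilClassesMinus At φt n dK)
    (hU'p : complexBetti.map et.hom (2 * n) (𝐣[t, 2 * n] U'p) ∈ weilClassesPlus At φt n dK)
    (hM : ∃ M : complexBetti (fiberOver f t) (2 * n) →ₗ[ℂ] complexBetti 𝒳 (2 * n), IsAlgebraicCorrespondence (d + 1) d 𝒳 (fiberOver f t) M ∧
      (∀ W, 𝐣[t, 2 * n] (M (𝐣[t, 2 * n] W)) = 𝐣[t, 2 * n] W) ∧ ∀ x, 𝐆[hf, t, 2 * n] x = 0 → 𝐣[t, 2 * n] (M x) = 0) :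
    weilClassesOf (As.prod At) Φ (n + n) dK ≤ algebraicClasses (As.prod At).X (n + n) := by
  subst hn
  have hXt := hf.isSmoothProjective_fiberOver t
  have hAs : As.dim = 2 * n := by rw [Andre1996.compactPencil_dim_eq_of_iso hf es, two_mul]
  have hAt : At.dim = 2 * n := by rw [Andre1996.compactPencil_dim_eq_of_iso hf et, two_mul]
  have h2 : 2 * n + 2 * n = 2 * (n + n) := two_mul_add_two_mul n n
  -- the three-term class is algebraic on `X_s × X_t`, hence so is its mixed part
  have hC := crossSum_three_restrict_mem_algebraicClasses_of_halfInverse hf t s (p := n) (q := n) rfl Θ Up Um Θ' U'm U'p hθθ hθm hθp hpθ hpm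
    hpp hmθ hmm hmp hspan νs As es hN hes hM
  have hθterm : cupProduct h2 (complexBetti.map (fst (fiberOver f s) (fiberOver f t)) (2 * n) (𝐣[s, 2 * n] Θ))
      (complexBetti.map (snd (fiberOver f s) (fiberOver f t)) (2 * n) (𝐣[t, 2 * n] Θ')) ∈ algebraicClasses (fiberOver f s ⊗ fiberOver f t) (n + n) :=
    (cross_mem_algebraicClasses_iff_chart es et (𝐣[s, 2 * n] Θ) (𝐣[t, 2 * n] Θ') h2).2
      (cupProduct_map_fst_map_snd_mem_algebraicClasses_prod (Motives.AbelianVariety.isSmoothProjective_holds (A := As))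
        (Motives.AbelianVariety.isSmoothProjective_holds (A := At)) ((mem_algebraicClasses_map_iff_of_iso es).2 hΘ)
        ((mem_algebraicClasses_map_iff_of_iso et).2 hΘ'))
  have hmixed : cupProduct h2 (complexBetti.map (fst (fiberOver f s) (fiberOver f t)) (2 * n) (𝐣[s, 2 * n] Up))
        (complexBetti.map (snd (fiberOver f s) (fiberOver f t)) (2 * n) (𝐣[t, 2 * n] U'm)) +
      cupProduct h2 (complexBetti.map (fst (fiberOver f s) (fiberOver f t)) (2 * n) (𝐣[s, 2 * n] Um))
        (complexBetti.map (snd (fiberOver f s) (fiberOver f t)) (2 * n) (𝐣[t, 2 * n] U'p)) ∈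
      algebraicClasses (fiberOver f s ⊗ fiberOver f t) (n + n) := by
    have h := Submodule.sub_mem _ hC hθterm
    rwa [show ∀ a b c : complexBetti (fiberOver f s ⊗ fiberOver f t) (2 * (n + n)), a + b + c - a = b + c from fun a b c ↦ by abel] at h
  -- chart it to the abelian variety `A_s × A_t`
  have hmixed' := (mem_algebraicClasses_map_iff_of_iso (tensorIso es et)).2 hmixed
  rw [show (tensorIso es et).hom = es.hom ⊗ₘ et.hom from rfl, map_add, map_tensorHom_cross es.hom et.hom h2, map_tensorHom_cross es.hom et.hom h2]
    at hmixed'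
  -- non-vanishing of `u₊(s)` and `u'₋(t)` from `∫ u₊(t) ∪ u'₋(t) = 1`
  have hUpt : 𝐣[t, 2 * n] Up ≠ 0 := fun h0 ↦ by
    rw [h0, map_zero, LinearMap.zero_apply, map_zero] at hpm
    exact zero_ne_one hpm
  have hU'mt : 𝐣[t, 2 * n] U'm ≠ 0 := fun h0 ↦ by
    rw [h0, map_zero, map_zero] at hpm
    exact zero_ne_one hpm
  have hUps : 𝐣[s, 2 * n] Up ≠ 0 := fun h0 ↦ hUpt (by
    have hmem : Up ∈ LinearMap.ker 𝐣[s, 2 * n] := LinearMap.mem_ker.2 h0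
    rw [ker_map_fiberι_eq hf (2 * n) s t] at hmem
    exact LinearMap.mem_ker.1 hmem)
  have hinj : ∀ {Y : SchemeOver ℂ} {B : AbelianVariety ℂ} (eB : B.X ≅ Y) {z : complexBetti Y (2 * n)}, z ≠ 0 →
      complexBetti.map eB.hom (2 * n) z ≠ 0 := fun eB z hz h0 ↦ hz (by
    have := congrArg (complexBetti.map eB.inv (2 * n)) h0
    rwa [← complexBetti.map_comp_apply, eB.inv_hom_id, complexBetti.map_id, map_zero] at this)
  exact weilClassesOf_twistedProd_le_algebraicClasses_of_mixed_mem hΦ₁ hΦ₂ hdK hφt hφs (n₁ := n) (n₂ := n) (by omega) hAs hAt hUp hUm hU'p hU'm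
    (hinj es hUps) (hinj et hU'mt) hmixed'

end Necessary

end Summit.HodgeConjecture.HodgeConjecture.Ring2.AbelianAll

end
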